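import Summits.FinalStateConjecture.FinalStateConjecture.Theses.SwallowTheDatum
import Summits.FinalStateConjecture.FinalStateConjecture.Theorems.SwallowTheDatumUniversalWitnessFamilyStubSheetDataEmbeddingCalculus
import Literature.Geometry.Lorentzian.SchwarzschildKerrSchildKoszul
import Literature.Geometry.Lorentzian.ModelData
import Literature.Geometry.Lorentzian.ChartSecondFundamentalForm
import Literature.Topology.FourManifolds.ImmersionCriterion
import HarnessLib

/-!
# Crux `SwallowTheDatum.UniversalWitnessFamily` (stmt-FinalStateConjecture-10051), line `Sketch`
# (throat-settles-too), stub `stub_sheetDataEmbedding`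

**The static slice of the open sheet is a data embedding into the Kerr–Schild Schwarzschild
exterior.**  For `M > 0`, ANY `ψ : {‖y‖ > M/2} → Kerr.region 0 (r₊(M, 0)) = {r > 2M}` with
`ψ(y) = (2M log(r/2M − 1), (1 + M/2ρ)² y)`, `ρ = ‖y‖`, `r = ρ (1 + M/2ρ)²` (the slice `{t = 0}`
of static time `t = t* − 2M log(r/2M − 1)` of the ingoing chart `g = η + (2M/r) ℓ ⊗ ℓ`, over the
isotropic chart) and ANY field `ν = (1 − 2M/r)^{-1/2} ∂_{t*}` along it satisfy the registered
signature `stub_sheetDataEmbedding` verbatim: `ψ` is a smooth embedding, `ν` its future unit normal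
for `Kerr.timeOrientation`, `ψ^* g_{M,0} = (1 + M/2ρ)⁴ δ` (the metric of
`Schwarzschild.timeSymmetricExteriorData M`; MTW 1973, (31.22)), and the second fundamental form
vanishes.  With `dψ` in closed form (`fderiv_sheet_apply` of the support file
`SwallowTheDatumUniversalWitnessFamilyStubSheetDataEmbeddingCalculus.lean`) everything is explicit
algebra with `Kerr.bilin M 0`: normality (`bilin_basisVector_tangent`; `dT = 2M dr/(r − 2M)`), the
induced metric (`bilin_tangent_tangent`), `g(∂_{t*}, ∂_{t*}) = −(1 − 2M/r)`, and `K_ν = 0` through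
`OpensChart.secondFundamentalForm_eq_of_repr`: `K_ν(v, w) = g(DN v + Γ(N)(dψ v), dψ w)`,
`DN v ∥ ∂_{t*} ⊥ dψ w`, `2 g(Γ(∂_{t*})(X), Z) = (2M/r²) Q(∂_{t*}; X, Z)`
(`Schwarzschild.koszulForm_eq_kForm`) and `Q(∂_{t*}; dψ v, dψ w) = 0` (`kCore_tangent`: the static
Killing field is hypersurface-orthogonal).  The embedding half: a continuous left inverse of
`y ↦ (1 + M/2ρ)² y` on `E3` (`exists_leftInverse_spaceMap`) and the immersion criterion
`Literature.Topology.FourManifolds.isImmersion_of_injective_mfderiv`.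

References: C. W. Misner, K. S. Thorne, J. A. Wheeler, *Gravitation* (1973), §31.7, (31.22);
R. M. Wald, *General Relativity* (1984), §6.4, (10.2.13); B. O'Neill, *Semi-Riemannian geometry*
(1983), Ch. 3, Prop. 3.13, Ch. 4, Lemma 4.4; M. Dafermos, I. Rodnianski, arXiv:0811.0354, §5.1.
-/

set_option linter.dupNamespace false

noncomputable section

namespace Summit.FinalStateConjecture.FinalStateConjecture.Theorems.SwallowTheDatum.UniversalWitnessFamily

open scoped Manifold ContDiff Topology InnerProductSpace
open Set Function Literature.Geometry.Lorentzian

/-! ### Metric algebra at a sheet point: `g = η + (2M/r) ℓ ⊗ ℓ` on slice tangents -/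

section Algebra

variable {M : ℝ} {y : E3}

/-- `‖(1 + M/(2ρ))² y‖ = ρ (1 + M/(2ρ))² = r`: the image point has spatial norm the areal radius
(MTW 1973, (31.22)). -/
theorem norm_spaceMap (M : ℝ) (y : E3) :
    ‖(1 + M / (2 * ‖y‖)) ^ 2 • y‖ = ‖y‖ * (1 + M / (2 * ‖y‖)) ^ 2 := by
  rw [norm_smul, Real.norm_of_nonneg (sq_nonneg _), mul_comm]

/-- The Kerr–Schild (areal) radius of a point over the sheet is `r = ρ (1 + M/(2ρ))²`. -/
theorem spatialNorm_sheet (M t : ℝ) (y : E3) :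
    E4.spatialNorm (E4.ofTimeSpace t ((1 + M / (2 * ‖y‖)) ^ 2 • y)) =
      ‖y‖ * (1 + M / (2 * ‖y‖)) ^ 2 := by
  rw [E4.spatialNorm_ofTimeSpace, norm_spaceMap]

/-- Points over the sheet are off the time axis: `r ≠ 0` (`y ≠ 0`, `2‖y‖ + M ≠ 0`). -/
theorem spatialNorm_sheet_ne_zero (hy : y ≠ 0) (hφ : 2 * ‖y‖ + M ≠ 0) (t : ℝ) :
    E4.spatialNorm (E4.ofTimeSpace t ((1 + M / (2 * ‖y‖)) ^ 2 • y)) ≠ 0 := by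
  have h2 : (2 : ℝ) * ‖y‖ ≠ 0 := mul_ne_zero two_ne_zero (norm_ne_zero_iff.2 hy)
  have hφ' : 1 + M / (2 * ‖y‖) ≠ 0 := by
    rw [one_add_div h2]
    exact div_ne_zero hφ h2
  rw [spatialNorm_sheet]
  exact mul_ne_zero (norm_ne_zero_iff.2 hy) (pow_ne_zero 2 hφ')

/-- **Normality of `∂_{t*}` to the static slice**: `g(∂_{t*}, dψ_y v) = 0` over the sheet point
`y` (`y ≠ 0`, `2‖y‖ ≠ ±M`), for any `L` agreeing with the closed-form differential `dψ_y`
(`fderiv_sheet_apply`): `g(∂_{t*}, A) = −A⁰ (1 − 2M/r) + (2M/r) dr(A⃗)`, `dT = 2M dr/(r − 2M)`.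
Wald 1984, §6.4. -/
theorem bilin_basisVector_tangent (hy : y ≠ 0) (hk : 2 * ‖y‖ - M ≠ 0) (hφ : 2 * ‖y‖ + M ≠ 0)
    (t : ℝ) {L : E3 →L[ℝ] E4}
    (hL : ∀ v, L v = E4.ofTimeSpace (2 * M * (2 * ‖y‖ + M) / (‖y‖ * (2 * ‖y‖ - M)) * ‖y‖⁻¹ * ⟪y, v⟫_ℝ)
      ((1 + M / (2 * ‖y‖)) ^ 2 • v + ((-(M * (1 + M / (2 * ‖y‖)) / ‖y‖ ^ 3)) * ⟪y, v⟫_ℝ) • y))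
    (v : E3) :
    Kerr.bilin M 0 (E4.ofTimeSpace t ((1 + M / (2 * ‖y‖)) ^ 2 • y)) (E4.basisVector 0) (L v) = 0 := by
  have hρ : ‖y‖ ≠ 0 := norm_ne_zero_iff.2 hy
  rw [Kerr.bilin_zero_spin_apply M (spatialNorm_sheet_ne_zero hy hφ t), spatialNorm_sheet]
  simp only [Kerr.basisVector_zero_apply_zero, Kerr.spatial_basisVector_zero, inner_zero_left,
    inner_zero_right, E4.spatial_ofTimeSpace, E4.ofTimeSpace_apply_zero, hL,
    inner_add_right, real_inner_smul_right, real_inner_smul_left, real_inner_self_eq_norm_sq,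
    zero_div, add_zero, one_mul]
  field_simp
  ring

/-- **The induced metric of the static slice is `(1 + M/(2ρ))⁴ δ`**:
`g(dψ_y v, dψ_y w) = (1 + M/(2ρ))⁴ ⟪v, w⟫`, i.e. `(1 − 2M/r)⁻¹ dr² + r² dΩ² = (1 + M/(2ρ))⁴ δ`
(MTW 1973, (31.22)), for any `L` agreeing with `dψ_y`. -/
theorem bilin_tangent_tangent (hy : y ≠ 0) (hk : 2 * ‖y‖ - M ≠ 0) (hφ : 2 * ‖y‖ + M ≠ 0)
    (t : ℝ) {L : E3 →L[ℝ] E4}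
    (hL : ∀ v, L v = E4.ofTimeSpace (2 * M * (2 * ‖y‖ + M) / (‖y‖ * (2 * ‖y‖ - M)) * ‖y‖⁻¹ * ⟪y, v⟫_ℝ)
      ((1 + M / (2 * ‖y‖)) ^ 2 • v + ((-(M * (1 + M / (2 * ‖y‖)) / ‖y‖ ^ 3)) * ⟪y, v⟫_ℝ) • y))
    (v w : E3) :
    Kerr.bilin M 0 (E4.ofTimeSpace t ((1 + M / (2 * ‖y‖)) ^ 2 • y)) (L v) (L w) =
      (1 + M / (2 * ‖y‖)) ^ 4 * ⟪v, w⟫_ℝ := by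
  have hρ : ‖y‖ ≠ 0 := norm_ne_zero_iff.2 hy
  rw [Kerr.bilin_zero_spin_apply M (spatialNorm_sheet_ne_zero hy hφ t), spatialNorm_sheet]
  simp only [E4.spatial_ofTimeSpace, E4.ofTimeSpace_apply_zero, hL,
    inner_add_right, real_inner_smul_right, inner_add_left, real_inner_smul_left,
    real_inner_self_eq_norm_sq, real_inner_comm v y, real_inner_comm w y, real_inner_comm w v]
  field_simp
  ring

/-- `g(∂_{t*}, ∂_{t*}) = −(1 − 2M/r)` over the sheet (`g_{t*t*} = −1 + 2H`, `H = M/r`;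
Dafermos–Rodnianski arXiv:0811.0354, §5.1). -/
theorem bilin_basisVector_basisVector (hy : y ≠ 0) (hφ : 2 * ‖y‖ + M ≠ 0) (t : ℝ) :
    Kerr.bilin M 0 (E4.ofTimeSpace t ((1 + M / (2 * ‖y‖)) ^ 2 • y)) (E4.basisVector 0)
      (E4.basisVector 0) = -(1 - 2 * M / (‖y‖ * (1 + M / (2 * ‖y‖)) ^ 2)) := by
  rw [Kerr.bilin_zero_spin_apply M (spatialNorm_sheet_ne_zero hy hφ t), spatialNorm_sheet]
  simp only [Kerr.basisVector_zero_apply_zero, Kerr.spatial_basisVector_zero,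
    inner_zero_right, zero_div, add_zero, mul_one]
  ring

/-- **The Koszul bracket of `∂_{t*}` vanishes on slice tangents**: with `K = (2M/r²) Q` the
closed-form Christoffel symbols of the first kind of `Kerr.bilin M 0`
(`Schwarzschild.koszulForm_eq_kForm`), `Q(∂_{t*}; X, Z) = ν(Z) X⁰ − ν(X) Z⁰`, and for `X = dψ v`,
`Z = dψ w` both `X⁰` and `ν(X)` are fixed multiples of `⟪y, ·⟫`, so `Q = 0`: the static slice is
totally geodesic (O'Neill 1983, Ch. 4, Lemma 4.4; Wald 1984, (10.2.13)). -/
theorem kCore_tangent (M t : ℝ) (y : E3) {L : E3 →L[ℝ] E4}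
    (hL : ∀ v, L v = E4.ofTimeSpace (2 * M * (2 * ‖y‖ + M) / (‖y‖ * (2 * ‖y‖ - M)) * ‖y‖⁻¹ * ⟪y, v⟫_ℝ)
      ((1 + M / (2 * ‖y‖)) ^ 2 • v + ((-(M * (1 + M / (2 * ‖y‖)) / ‖y‖ ^ 3)) * ⟪y, v⟫_ℝ) • y))
    (v w : E3) :
    Schwarzschild.kCore (E4.ofTimeSpace t ((1 + M / (2 * ‖y‖)) ^ 2 • y)) (E4.basisVector 0)
      (L v) (L w) = 0 := by
  simp only [Schwarzschild.kCore, Schwarzschild.proj, Schwarzschild.ell, Schwarzschild.nu,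
    Schwarzschild.sdot, Kerr.basisVector_zero_apply_zero, Kerr.spatial_basisVector_zero,
    inner_zero_right, E4.spatial_ofTimeSpace, E4.ofTimeSpace_apply_zero, hL, inner_add_right,
    real_inner_smul_right, real_inner_smul_left]
  ring

/-- **Registered sub-goal `sheetDataEmbedding_staticNorm` of stub `stub_sheetDataEmbedding`**:
`g_{M,0}(∂_{t*}, ∂_{t*}) = −(1 − 2M/r)` over a sheet point (`bilin_basisVector_basisVector`). -/
theorem sheetDataEmbedding_staticNorm : ∀ (M : ℝ) (y : E3), y ≠ 0 → 2 * ‖y‖ + M ≠ 0 → ∀ t : ℝ, Kerr.bilin M 0 (E4.ofTimeSpace t ((1 + M / (2 * ‖y‖)) ^ 2 • y)) (E4.basisVector 0) (E4.basisVector 0) = -(1 - 2 * M / (‖y‖ * (1 + M / (2 * ‖y‖)) ^ 2)) :=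
  fun _ _ hy hφ t ↦ bilin_basisVector_basisVector hy hφ t

end Algebra

/-! ### The sheet: elementary facts, and a left inverse of the space map -/

section Sheet

variable {M : ℝ}

/-- **A continuous left inverse of the isotropic space map** `y ↦ (1 + M/(2ρ))² y` on the sheet
`‖y‖ > M/2` (`M > 0`), defined on all of `E3`: `x ↦ (ρ(r)/r) x`, `ρ(r) = (r − M + √(r² − 2Mr))/2`,
`r = max(‖x‖, 2M)` (`r² − 2Mr = (ρ (1 + M/2ρ)(1 − M/2ρ))²`). MTW 1973, (31.22). -/
theorem exists_leftInverse_spaceMap (hM : 0 < M) :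
    ∃ g : E3 → E3, Continuous g ∧ ∀ y : E3, M / 2 < ‖y‖ → g ((1 + M / (2 * ‖y‖)) ^ 2 • y) = y := by
  refine ⟨fun x ↦ ((max ‖x‖ (2 * M) - M +
    Real.sqrt (max ‖x‖ (2 * M) ^ 2 - 2 * M * max ‖x‖ (2 * M))) / (2 * max ‖x‖ (2 * M))) • x, ?_,
    fun y hy ↦ ?_⟩
  · have hm : Continuous fun x : E3 ↦ max ‖x‖ (2 * M) := continuous_norm.max continuous_const
    have hc : Continuous fun x : E3 ↦ (max ‖x‖ (2 * M) - M +
        Real.sqrt (max ‖x‖ (2 * M) ^ 2 - 2 * M * max ‖x‖ (2 * M))) / (2 * max ‖x‖ (2 * M)) := by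
      refine Continuous.div ?_ (continuous_const.mul hm) fun x ↦ ?_
      · exact (hm.sub continuous_const).add ((hm.pow 2).sub (continuous_const.mul hm)).sqrt
      · exact mul_ne_zero two_ne_zero (ne_of_gt (lt_of_lt_of_le (by positivity) (le_max_right _ _)))
    exact hc.smul continuous_id
  · have hρ : 0 < ‖y‖ := lt_trans (by positivity) hy
    have h2 : (0 : ℝ) < 2 * ‖y‖ := by positivity
    have hk : 0 < 1 - M / (2 * ‖y‖) := by
      rw [one_sub_div h2.ne']
      exact div_pos (by linarith) h2
    have hφ : 0 < 1 + M / (2 * ‖y‖) := by positivity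
    have hgt : 2 * M < ‖y‖ * (1 + M / (2 * ‖y‖)) ^ 2 := by
      have h := areal_sub_two_mul M hρ.ne'
      nlinarith [mul_pos hρ (pow_pos hk 2)]
    dsimp only
    rw [norm_spaceMap, max_eq_left hgt.le]
    have hsq : (‖y‖ * (1 + M / (2 * ‖y‖)) ^ 2) ^ 2 - 2 * M * (‖y‖ * (1 + M / (2 * ‖y‖)) ^ 2) =
        (‖y‖ * (1 + M / (2 * ‖y‖)) * (1 - M / (2 * ‖y‖))) ^ 2 := by
      field_simp
      ring
    rw [hsq, Real.sqrt_sq (mul_nonneg (mul_nonneg hρ.le hφ.le) hk.le), smul_smul]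
    have h1 : (‖y‖ * (1 + M / (2 * ‖y‖)) ^ 2 - M + ‖y‖ * (1 + M / (2 * ‖y‖)) * (1 - M / (2 * ‖y‖))) /
        (2 * (‖y‖ * (1 + M / (2 * ‖y‖)) ^ 2)) * (1 + M / (2 * ‖y‖)) ^ 2 = 1 := by
      field_simp
      ring
    rw [h1, one_smul]

/-- Points of the sheet are away from the origin (`M > 0`). -/
theorem sheet_norm_pos (hM : 0 < M) (y : Schwarzschild.isotropicExterior M) : 0 < ‖(y : E3)‖ :=
  lt_trans (by positivity) (Schwarzschild.mem_isotropicExterior.1 y.2)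

/-- `2ρ − M ≠ 0` on the sheet. -/
theorem sheet_k_ne (y : Schwarzschild.isotropicExterior M) : 2 * ‖(y : E3)‖ - M ≠ 0 :=
  ne_of_gt (by linarith [Schwarzschild.mem_isotropicExterior.1 y.2])

/-- `2ρ + M ≠ 0` on the sheet (`M > 0`). -/
theorem sheet_phi_ne (hM : 0 < M) (y : Schwarzschild.isotropicExterior M) :
    2 * ‖(y : E3)‖ + M ≠ 0 :=
  ne_of_gt (by linarith [norm_nonneg (y : E3)])

/-- **The sheet maps into the exterior**: `r = ρ (1 + M/(2ρ))² > 2M` for `ρ > M/2 > 0`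
(`r − 2M = ρ (1 − M/(2ρ))² > 0`; MTW 1973, §31.7), so `1 − 2M/r > 0`: the lapse `(1 − 2M/r)^{-1/2}`
is well defined and positive. -/
theorem sheet_lapse_arg_pos (hM : 0 < M) (y : Schwarzschild.isotropicExterior M) :
    0 < 1 - 2 * M / (‖(y : E3)‖ * (1 + M / (2 * ‖(y : E3)‖)) ^ 2) := by
  have hρ := sheet_norm_pos hM y
  have h2 : (0 : ℝ) < 2 * ‖(y : E3)‖ := by positivity
  have hk : 0 < 1 - M / (2 * ‖(y : E3)‖) := by
    rw [one_sub_div h2.ne']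
    exact div_pos (by linarith [Schwarzschild.mem_isotropicExterior.1 y.2]) h2
  have h := areal_sub_two_mul M hρ.ne'
  have hgt : 2 * M < ‖(y : E3)‖ * (1 + M / (2 * ‖(y : E3)‖)) ^ 2 := by
    nlinarith [mul_pos hρ (pow_pos hk 2)]
  have hr : 0 < ‖(y : E3)‖ * (1 + M / (2 * ‖(y : E3)‖)) ^ 2 := lt_trans (by positivity) hgt
  rw [sub_pos, div_lt_one hr]
  exact hgt

end Sheet

/-- **Stub `stub_sheetDataEmbedding` (line `Sketch` of crux `SwallowTheDatum.UniversalWitnessFamily`).**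
For `M > 0`, any `ψ : {‖y‖ > M/2} → {r > 2M}` given by the static slice formula
`ψ(y) = (2M log(r/2M − 1), (1 + M/2ρ)² y)`, `r = ρ (1 + M/2ρ)²`, and any field
`ν = (1 − 2M/r)^{-1/2} ∂_{t*}` along it form a DATA EMBEDDING of the open-sheet datum
`Schwarzschild.timeSymmetricExteriorData M = ((1 + M/2ρ)⁴ δ, 0)` into the Kerr–Schild Schwarzschild
exterior: `ψ` is a smooth embedding, `ν` its future unit normal for `Kerr.timeOrientation`,
`ψ^* g_{M,0} = (1 + M/2ρ)⁴ δ`, and the second fundamental form vanishes (the static Killing field is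
hypersurface-orthogonal). MTW 1973, §31.7, (31.22); Wald 1984, §6.4; O'Neill 1983, Ch. 4, Lemma 4.4. -/
theorem stub_sheetDataEmbedding :
  ∀ [Kerr.Facts] (M : ℝ) (hM : 0 < M)
    (ψ : Schwarzschild.isotropicExterior M → Kerr.region 0 (Kerr.rPlus M 0)) (ν : NormalField 𝓘(ℝ, E4) ψ),
    (∀ y, (ψ y : E4) =
      E4.ofTimeSpace (2 * M * Real.log (‖(y : E3)‖ * (1 + M / (2 * ‖(y : E3)‖)) ^ 2 / (2 * M) - 1))
        ((1 + M / (2 * ‖(y : E3)‖)) ^ 2 • (y : E3))) →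
    (∀ y, ν y = (Real.sqrt (1 - 2 * M / (‖(y : E3)‖ * (1 + M / (2 * ‖(y : E3)‖)) ^ 2)))⁻¹ •
      E4.basisVector 0) →
    Manifold.IsSmoothEmbedding 𝓘(ℝ, E3) 𝓘(ℝ, E4) ∞ ψ ∧
    (Kerr.smoothMetric M 0 (Kerr.rPlus M 0)).IsFutureUnitNormal 𝓘(ℝ, E3)
      ((Kerr.timeOrientation M 0 (Kerr.rPlus M 0) hM.le).ofLE le_top) ψ ν ∧
    (∀ y, pullbackBilin (I := 𝓘(ℝ, E4)) (I' := 𝓘(ℝ, E3)) ψ (Kerr.smoothMetric M 0 (Kerr.rPlus M 0)).val y =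
      (Schwarzschild.timeSymmetricExteriorData M hM.le).h.inner y) ∧
    (∀ [(Kerr.smoothMetric M 0 (Kerr.rPlus M 0)).toPseudoRiemannianMetric.HasLeviCivita]
      (y : Schwarzschild.isotropicExterior M),
      (Kerr.smoothMetric M 0 (Kerr.rPlus M 0)).toPseudoRiemannianMetric.secondFundamentalForm 𝓘(ℝ, E3) ψ ν y =
        (Schwarzschild.timeSymmetricExteriorData M hM.le).kBilin y) := by
  intro _ M hM ψ ν hψ hν
  have hMne : M ≠ 0 := hM.ne'
  have hy0 : ∀ y : Schwarzschild.isotropicExterior M, (y : E3) ≠ 0 :=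
    fun y ↦ norm_pos_iff.1 (sheet_norm_pos hM y)
  set Φ : E3 → E4 := fun z ↦ E4.ofTimeSpace
    (2 * M * Real.log (‖z‖ * (1 + M / (2 * ‖z‖)) ^ 2 / (2 * M) - 1)) ((1 + M / (2 * ‖z‖)) ^ 2 • z)
  set Nr : E3 → E4 := fun z ↦
    (Real.sqrt (1 - 2 * M / (‖z‖ * (1 + M / (2 * ‖z‖)) ^ 2)))⁻¹ • E4.basisVector 0
  have hψ' : ∀ y, (ψ y : E4) = Φ y := fun y ↦ hψ y
  have hν' : ∀ y, ν y = Nr y := fun y ↦ hν y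
  have hΦd : ∀ y : Schwarzschild.isotropicExterior M, DifferentiableAt ℝ Φ y := fun y ↦
    (hasFDerivAt_sheet hMne (hy0 y) (sheet_k_ne y)).differentiableAt
  have hmf : ∀ (y : Schwarzschild.isotropicExterior M) (v : E3),
      mfderiv 𝓘(ℝ, E3) 𝓘(ℝ, E4) ψ y v = fderiv ℝ Φ y v := fun y v ↦
    OpensChart.mfderiv_apply_of_repr hψ' (hΦd y) v
  have hL : ∀ (y : Schwarzschild.isotropicExterior M) (v : E3), fderiv ℝ Φ y v =
      E4.ofTimeSpace (2 * M * (2 * ‖(y : E3)‖ + M) / (‖(y : E3)‖ * (2 * ‖(y : E3)‖ - M)) *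
        ‖(y : E3)‖⁻¹ * ⟪(y : E3), v⟫_ℝ) ((1 + M / (2 * ‖(y : E3)‖)) ^ 2 • v +
          ((-(M * (1 + M / (2 * ‖(y : E3)‖)) / ‖(y : E3)‖ ^ 3)) * ⟪(y : E3), v⟫_ℝ) • (y : E3)) :=
    fun y v ↦ fderiv_sheet_apply hMne (hy0 y) (sheet_k_ne y) v
  have hsmooth : ContMDiff 𝓘(ℝ, E3) 𝓘(ℝ, E4) ∞ ψ := fun y ↦
    (ChartedSpace.liftPropWithinAt_subtypeVal_comp_iff ψ univ y).mp
      ((OpensChart.contMDiffAt_iff y (Subtype.val ∘ ψ) Φ hψ').mpr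
        (contDiffAt_sheet hMne (hy0 y) (sheet_k_ne y)))
  -- the induced metric, the normality and the unit length, at the level of `Kerr.bilin`
  have hind : ∀ (y : Schwarzschild.isotropicExterior M) (v w : E3),
      Kerr.bilin M 0 (ψ y : E4) (fderiv ℝ Φ y v) (fderiv ℝ Φ y w) =
        (1 + M / (2 * ‖(y : E3)‖)) ^ 4 * ⟪v, w⟫_ℝ := fun y v w ↦ by
    rw [hψ y]
    exact bilin_tangent_tangent (hy0 y) (sheet_k_ne y) (sheet_phi_ne hM y) _ (hL y) v w
  have hnor' : ∀ (y : Schwarzschild.isotropicExterior M) (v : E3),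
      Kerr.bilin M 0 (ψ y : E4) (E4.basisVector 0) (fderiv ℝ Φ y v) = 0 := fun y v ↦ by
    rw [hψ y]
    exact bilin_basisVector_tangent (hy0 y) (sheet_k_ne y) (sheet_phi_ne hM y) _ (hL y) v
  have hnor : ∀ (y : Schwarzschild.isotropicExterior M) (v : E3),
      Kerr.bilin M 0 (ψ y : E4) ((Real.sqrt (1 - 2 * M / (‖(y : E3)‖ *
        (1 + M / (2 * ‖(y : E3)‖)) ^ 2)))⁻¹ • E4.basisVector 0) (fderiv ℝ Φ y v) = 0 := fun y v ↦ by
    rw [map_smul, smul_apply, hnor', smul_zero]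
  have hunit : ∀ y : Schwarzschild.isotropicExterior M,
      Kerr.bilin M 0 (ψ y : E4)
        ((Real.sqrt (1 - 2 * M / (‖(y : E3)‖ * (1 + M / (2 * ‖(y : E3)‖)) ^ 2)))⁻¹ •
          E4.basisVector 0)
        ((Real.sqrt (1 - 2 * M / (‖(y : E3)‖ * (1 + M / (2 * ‖(y : E3)‖)) ^ 2)))⁻¹ •
          E4.basisVector 0) = -1 := fun y ↦ by
    have hu := sheet_lapse_arg_pos hM y
    rw [hψ y, map_smul, map_smul, smul_apply, bilin_basisVector_basisVector (hy0 y) (sheet_phi_ne hM y),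
      smul_eq_mul, smul_eq_mul, ← mul_assoc, ← mul_inv, Real.mul_self_sqrt hu.le, mul_neg,
      inv_mul_cancel₀ hu.ne']
  have hunit' : ∀ y : Schwarzschild.isotropicExterior M,
      (Kerr.smoothMetric M 0 (Kerr.rPlus M 0)).val (ψ y) (ν y) (ν y) = -1 := fun y ↦ by
    rw [Kerr.smoothMetric_val, hν y]
    exact hunit y
  refine ⟨⟨?_, ?_⟩, ⟨⟨fun y v ↦ ?_, hunit'⟩, fun y ↦ ⟨?_, ?_⟩⟩, fun y ↦ ?_, ?_⟩
  · -- (a₁) immersion: `dψ_y v = 0` forces `(1 + M/2ρ)⁴ ⟪v, v⟫ = g(0, 0) = 0`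
    refine Literature.Topology.FourManifolds.isImmersion_of_injective_mfderiv hsmooth
      (by exact_mod_cast le_top) fun y ↦ ?_
    refine (injective_iff_map_eq_zero _).2 fun v hv ↦ ?_
    have h1 : fderiv ℝ Φ (y : E3) v = (0 : E4) := (hmf y v).symm.trans hv
    have h := hind y v v
    rw [h1, map_zero] at h
    have hφ4 : (1 + M / (2 * ‖(y : E3)‖)) ^ 4 ≠ 0 := by
      have := sheet_norm_pos hM y
      positivity
    exact inner_self_eq_zero.1 ((mul_eq_zero.1 h.symm).resolve_left hφ4)
  · -- (a₂) topological embedding: the spatial part has a continuous left inverse on `E3`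
    obtain ⟨g, hgc, hg⟩ := exists_leftInverse_spaceMap hM
    set F : Schwarzschild.isotropicExterior M → E3 :=
      fun y ↦ (1 + M / (2 * ‖(y : E3)‖)) ^ 2 • (y : E3) with hF
    have hFc : Continuous F := by
      have hc : Continuous fun y : Schwarzschild.isotropicExterior M ↦ (1 + M / (2 * ‖(y : E3)‖)) ^ 2 :=
        (continuous_const.add (continuous_const.div (continuous_const.mul
          (continuous_norm.comp continuous_subtype_val)) fun y ↦
            mul_ne_zero two_ne_zero (sheet_norm_pos hM y).ne')).pow 2
      exact hc.smul continuous_subtype_val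
    have hFe : Topology.IsEmbedding F := by
      refine Topology.IsEmbedding.of_comp hFc hgc ?_
      have hcomp : g ∘ F = Subtype.val :=
        funext fun y ↦ hg y (Schwarzschild.mem_isotropicExterior.1 y.2)
      rw [hcomp]
      exact Topology.IsEmbedding.subtypeVal
    refine Topology.IsEmbedding.of_comp hsmooth.continuous
      (E4.spatial.continuous.comp continuous_subtype_val) ?_
    have hcomp : (E4.spatial ∘ Subtype.val) ∘ ψ = F := funext fun y ↦ by
      simp only [Function.comp_apply, hψ y, E4.spatial_ofTimeSpace, hF]
    rw [hcomp]
    exact hFe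
  · -- (b₁) normality `g(ν, dψ v) = 0`
    rw [Kerr.smoothMetric_val, hmf, hν y]
    exact hnor y v
  · -- (b₂) causal (indeed unit timelike)
    have ht : (Kerr.smoothMetric M 0 (Kerr.rPlus M 0)).IsTimelike (ν y) := by
      rw [LorentzianMetric.isTimelike_iff, hunit' y]
      norm_num
    exact ht.isCausal
  · -- (b₃) future-directed: `g(V, ν) = −ν⁰ < 0` for the orienting field `V = −g♯dt*`
    have hrad : 0 < Kerr.radius 0 (ψ y : E4) := Kerr.radius_pos_of_mem_region (ψ y).2
    have hu := sheet_lapse_arg_pos hM y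
    have h : Kerr.bilin M 0 (ψ y : E4) (Kerr.timeVector M 0 (ψ y : E4))
        ((Real.sqrt (1 - 2 * M / (‖(y : E3)‖ * (1 + M / (2 * ‖(y : E3)‖)) ^ 2)))⁻¹ •
          E4.basisVector 0) < 0 := by
      rw [Kerr.bilin_timeVector hrad, PiLp.smul_apply, Kerr.basisVector_zero_apply_zero, smul_eq_mul,
        mul_one, neg_lt_zero, inv_pos]
      exact Real.sqrt_pos.2 hu
    rw [TimeOrientation.vectorField_ofLE, Kerr.smoothMetric_val, hν y]
    exact h
  · -- (c) induced metric `ψ^* g = (1 + M/2ρ)⁴ δ`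
    refine ContinuousLinearMap.ext fun v ↦ ContinuousLinearMap.ext fun w ↦ ?_
    rw [pullbackBilin_apply, Kerr.smoothMetric_val, Schwarzschild.timeSymmetricExteriorData_h_inner,
      Schwarzschild.conformalFactor_apply, hmf, hmf]
    exact hind y v w
  · -- (d) the second fundamental form vanishes
    intro _ y
    refine LinearMap.ext₂ fun v w ↦ ?_
    have h0 : (Schwarzschild.timeSymmetricExteriorData M hM.le).kBilin y v w = 0 := rfl
    have hy := hy0 y
    have hu := sheet_lapse_arg_pos hM y
    rw [h0, OpensChart.secondFundamentalForm_eq_of_repr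
      (g := (Kerr.smoothMetric M 0 (Kerr.rPlus M 0)).toPseudoRiemannianMetric) (G := Kerr.bilin M 0)
      (Kerr.smoothMetric_val M 0 (Kerr.rPlus M 0)) hψ' hν' (hΦd y)
      (differentiableAt_normal hy (sheet_phi_ne hM y) hu) (Kerr.differentiableAt_bilin M 0 _) v w]
    obtain ⟨c, hc⟩ := fderiv_normal_apply hy (sheet_phi_ne hM y) hu v
    have hc' : fderiv ℝ Nr y v = c • E4.basisVector 0 := hc
    rw [hc', show Nr y = (Real.sqrt (1 - 2 * M / (‖(y : E3)‖ * (1 + M / (2 * ‖(y : E3)‖)) ^ 2)))⁻¹ •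
        E4.basisVector 0 from rfl, OpensChart.christoffel_smul]
    show Kerr.bilin M 0 (ψ y : E4) (c • E4.basisVector 0 +
      (Real.sqrt (1 - 2 * M / (‖(y : E3)‖ * (1 + M / (2 * ‖(y : E3)‖)) ^ 2)))⁻¹ •
        OpensChart.christoffel (Kerr.smoothMetric M 0 (Kerr.rPlus M 0)).toPseudoRiemannianMetric
          (Kerr.bilin M 0) (ψ y) (E4.basisVector 0) (fderiv ℝ Φ y v)) (fderiv ℝ Φ y w) = 0
    have hx : E4.spatial (ψ y : E4) ≠ 0 := by
      rw [hψ y, E4.spatial_ofTimeSpace]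
      exact smul_ne_zero (pow_ne_zero 2 (ne_of_gt (by have := sheet_norm_pos hM y; positivity))) hy
    have hΓ : 2 * Kerr.bilin M 0 (ψ y : E4)
        (OpensChart.christoffel (Kerr.smoothMetric M 0 (Kerr.rPlus M 0)).toPseudoRiemannianMetric
          (Kerr.bilin M 0) (ψ y) (E4.basisVector 0) (fderiv ℝ Φ y v)) (fderiv ℝ Φ y w) =
        OpensChart.koszulForm (Kerr.bilin M 0) (ψ y : E4) (E4.basisVector 0) (fderiv ℝ Φ y v)
          (fderiv ℝ Φ y w) :=
      OpensChart.two_mul_val_christoffel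
        (g := (Kerr.smoothMetric M 0 (Kerr.rPlus M 0)).toPseudoRiemannianMetric) (G := Kerr.bilin M 0)
        (ψ y) (E4.basisVector 0) (fderiv ℝ Φ y v) (fderiv ℝ Φ y w)
    have hk0 : Schwarzschild.kCore (ψ y : E4) (E4.basisVector 0) (fderiv ℝ Φ y v)
        (fderiv ℝ Φ y w) = 0 := by
      rw [hψ y]
      exact kCore_tangent M _ y (hL y) v w
    rw [Schwarzschild.koszulForm_eq_kForm M hx, Schwarzschild.kForm, hk0, mul_zero] at hΓ
    rw [map_add, map_smul, map_smul, add_apply, smul_apply, smul_apply, hnor' y w,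
      smul_zero, zero_add, smul_eq_mul]
    have h2 : Kerr.bilin M 0 (ψ y : E4)
        (OpensChart.christoffel (Kerr.smoothMetric M 0 (Kerr.rPlus M 0)).toPseudoRiemannianMetric
          (Kerr.bilin M 0) (ψ y) (E4.basisVector 0) (fderiv ℝ Φ y v)) (fderiv ℝ Φ y w) = 0 := by
      linarith
    rw [h2, mul_zero]

end Summit.FinalStateConjecture.FinalStateConjecture.Theorems.SwallowTheDatum.UniversalWitnessFamily

end
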